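import Summits.BirchSwinnertonDyer.BirchSwinnertonDyer.Theorems.SchneiderFreeAdditiveX3PoitouTateReciprocitySumHolds
import Literature.NumberTheory.IwasawaTheory.Greenberg2016.RestrictedRamificationBridge
import Literature.NumberTheory.IwasawaTheory.Greenberg2016.SpecialisedSpecification
import Literature.NumberTheory.GaloisCohomology.RestrictedRamificationUnramifiedClasses
import HarnessLib

/-!
# Road «SUR-Λ» (crux 2 `GoodLatticeBDPValue`, by-name input #9 `Greenberg2016.prop263_sur_of_crk`),
# brick C6a: the FINITE-LEVEL POITOU–TATE LIFT in Greenberg's arena — one step (ε) of Greenberg 2010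
# Prop. 3.2.1 with the Kőnig/limit part factored out

Cell `bsd-eis`, width seat `bsd-line-x1-p1-w2` (gen 10); helper for stmt-BirchSwinnertonDyer-19032
(`--supports`), road memo `SUR-LAMBDA-ROAD-w5g9.md` §2 ★(ε), §7.4 C6.  THEOREMS ONLY (no definition,
no named fact, no `sorry`).

SETTING (Greenberg 2016 §1 / the tree's dictionary `SelmerGroupStructure.lean`): `K` a number field,
`S` a finite set of finite places, `ρ : ContinuousRep (GaloisGroupUnramifiedOutside K S) Λ D` on a
discrete `Λ`-module `D`, a specification `L : Specification S ρ` (`Λ`-submodules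
`L v ≤ H¹(K_v, 𝐃)`, `v ∈ Σ = S ∪ Ω_∞`), `φ_𝓛 = L.phi : H¹(K_Σ/K, 𝐃) → Q_𝓛 = ∏_{v∈Σ} H¹(K_v,𝐃)/L v`.
A FINITE LEVEL is a `ρ`-stable `Λ`-submodule `C ≤ 𝐃`, finite and killed by `n` (e.g. `𝐃[𝔪ᵏ]`,
`n = pᵏ`); `ρ_C := ρ.subrepresentation C`, and `σ_C := toGaloisModule S ρ_C` is the finite discrete
`Γ_K`-module it inflates to (`RestrictedRamificationBridge.lean`), to which the tree's Poitou–Tate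
theorem for THE canonical invariant maps applies
(`PoitouTateReduction.selmerComplement_canonical_holds`, Milne ADT I Thm. 4.10 (b) / Howard Thm. 2.1.11).

THE THEOREM `exists_phi_eq_of_level` (Greenberg, Kyoto J. Math. 50 (2010), proof of Prop. 3.2.1 /
§3.1, the finite-level core of "`S_{𝓛*}(K,T*) = 0 ⟹ φ_𝓛` surjective"): let `q ∈ Q_𝓛(K,𝐃)` be
represented at level `C` — local classes `s_v ∈ H¹(K_v, C)` (`v ∈ Σ`) whose images in `H¹(K_v, 𝐃)`
represent `q_v` (every `q` is so represented at some level: -w8 g11's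
`CoefficientLevels.exists_level_forall_localHmap_eq`) — and suppose the finite-level OBSTRUCTION
VANISHES: `∑_{v ∈ Σ} ⟨s_v, loc_v y⟩^{can}_n = 0` for every `y ∈ H¹(Γ_K, C^D)` in the dual Selmer group
of the level-`C` local conditions `𝓕 = (preimage of L v at v ∈ Σ, unramified off Σ)`.  Then
`q = φ_𝓛(x)` for some `x ∈ H¹(K_Σ/K, 𝐃)`.  PROOF: Poitou–Tate (i) for `𝓕 ≤ 𝓖 = (⊤ on Σ, unramified
off Σ)` gives `x_C ∈ H¹(Γ_K, C)` locally unramified off `Σ` with `loc_v x_C − s_v ∈ 𝓕_v`; by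
`RestrictedRamificationUnramifiedClasses.mem_range_restrictedInf_of_mem_selmerGroup` it is inflated from
`H¹(G_S, C)`, moved to `ρ_C.H 1` by `restrictedHAddEquiv` and pushed to `ρ.H 1` by `Hmap`; its
localisations are computed by THE SQUARE `loc_restrictedHAddEquiv` and `loc_Hmap_subtype_comm`.
The local conditions `𝓕`, `𝓖` and the Finset `T = Σ` are consumed through their defining properties
(hypotheses `h𝓕T`, `h𝓕ur`, `h𝓖T`, `h𝓖ur`, `hTinl`, `hTinr`), so that the consumer (brick C6b: the
Kőnig step `S* = 0 ⟹` the obstruction vanishes at some level, `DirectedSystemKonig.lean`) may build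
them as it likes.

HONEST FRAMING: a helper; closes no stub; no case of Greenberg's Prop. 2.6.3, of Poitou–Tate duality
beyond the tree's theorem it invokes, or of BSD is proved here; no summit statement is proved.
References: [Greenberg2010] Prop. 3.2.1 (p. 15), §3.1 Prop. 3.1.1 (p. 14); [Greenberg2016Selmer]
Prop. 2.6.3, §1 p. 3; [MilneADT2006] I Thm. 4.10 (b); [Howard2004HeegnerKolyvagin] Thm. 2.1.11.
-/

set_option autoImplicit false
set_option linter.dupNamespace false

noncomputable section

open CategoryTheory Function NumberField IsDedekindDomain Field
open scoped NumberField ContRepresentation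

universe u

namespace Summit.BirchSwinnertonDyer.BirchSwinnertonDyer.Theorems.SurLambda

open Literature.NumberTheory.GaloisRepresentations Literature.NumberTheory.GaloisCohomology
open Literature.NumberTheory.GaloisRepresentations.DiscreteGaloisModule (tateDual localTatePairingZMod
  restrictedCohomology restrictedLocalization restrictedInf unramifiedSubgroup SelmerStructure)
open Literature.NumberTheory.IwasawaTheory.Greenberg2016
open Summit.BirchSwinnertonDyer.BirchSwinnertonDyer.Theorems.SchneiderFreeAdditiveX3.PoitouTateReduction
  (selmerComplement_canonical_holds)

variable {K : Type} [Field K] [NumberField K] {S : Set (HeightOneSpectrum (𝓞 K))}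
  {Λ : Type} [CommRing Λ] [TopologicalSpace Λ]
  {D : Type} [AddCommGroup D] [Module Λ D] [TopologicalSpace D] [DiscreteTopology D]
  [ContinuousSMul Λ D]
  (ρ : ContinuousRep (GaloisGroupUnramifiedOutside K S) Λ D) (L : Specification S ρ)

/-- **The finite-level Poitou–Tate lift (Greenberg 2010, proof of Prop. 3.2.1, step (ε) at one
level).**  See the module docstring: if `q ∈ Q_𝓛(K, 𝐃)` is represented by local classes `s_v` of a
finite `n`-torsion stable level `C ≤ 𝐃` and the level-`n` obstruction
`y ↦ ∑_{v∈Σ} ⟨s_v, loc_v y⟩^{can}_n` kills the dual Selmer group of the level conditions, then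
`q ∈ im φ_𝓛`. [cite: Greenberg2010, Prop. 3.2.1 (p. 15) and Prop. 3.1.1 (p. 14)]
[cite: MilneADT2006, Ch. I, Thm. 4.10 (b)] [cite: Howard2004HeegnerKolyvagin, Thm. 2.1.11 (arXiv:1202.6340 p. 6)] -/
theorem exists_phi_eq_of_level {n : ℕ} [NeZero n]
    (hSn : ∀ v : HeightOneSpectrum (𝓞 K), ((n : ℕ) : 𝓞 K) ∈ v.asIdeal → v ∈ S)
    -- the level
    (C : Submodule Λ D) (hC : ∀ g : GaloisGroupUnramifiedOutside K S, C ≤ C.comap (ρ g))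
    [Finite C] (hn : ∀ c : C, n • c = 0)
    -- `Σ` as a Finset of places
    (T : Finset (Place K)) (hTinl : ∀ w : InfinitePlace K, (Sum.inl w : Place K) ∈ T)
    (hTinr : ∀ v : HeightOneSpectrum (𝓞 K), (Sum.inr v : Place K) ∈ T ↔ v ∈ S)
    -- the level local conditions: `𝓕` = preimage of `L`, `𝓖 = ⊤` on `Σ`, both unramified off `Σ`
    (𝓕 𝓖 : SelmerStructure (toGaloisModule S (ρ.subrepresentation C hC)))
    (h𝓕T : ∀ v ∈ T, ∀ z : galoisCohomology ((toGaloisModule S (ρ.subrepresentation C hC)).toLocal v) 1,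
      z ∈ 𝓕 v ↔
        Hmap (localRep S (ρ.subrepresentation C hC) v) (localRep S ρ v) C.subtypeL (fun _ _ ↦ rfl) 1
          (localHAddEquiv S (ρ.subrepresentation C hC) v 1 z) ∈ L v)
    (h𝓕ur : 𝓕.IsUnramifiedOutside T) (h𝓖T : ∀ v ∈ T, 𝓖 v = ⊤) (h𝓖ur : 𝓖.IsUnramifiedOutside T)
    -- the datum: local classes at level `C` representing `q`
    (q : L.QGlobal)
    (s : ∀ v : Place K, galoisCohomology ((toGaloisModule S (ρ.subrepresentation C hC)).toLocal v) 1)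
    (hs : ∀ v : SigmaPlace S,
      Submodule.Quotient.mk (p := L v.1)
        (Hmap (localRep S (ρ.subrepresentation C hC) v.1) (localRep S ρ v.1) C.subtypeL
          (fun _ _ ↦ rfl) 1 (localHAddEquiv S (ρ.subrepresentation C hC) v.1 1 (s v.1))) = q v)
    -- the obstruction vanishes at this level
    (hvanish : ∀ y ∈ ((LocalInvariants.canonical K n).dualSelmerStructure
        (toGaloisModule S (ρ.subrepresentation C hC)) 𝓕).selmerGroup,
      ∑ v ∈ T, localTatePairingZMod (toGaloisModule S (ρ.subrepresentation C hC)) n v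
        (LocalInvariants.canonical K n v) (s v)
        (galoisCohomology.localization ((toGaloisModule S (ρ.subrepresentation C hC)).tateDual n)
          v 1 y) = 0) :
    ∃ x : ρ.H 1, L.phi x = q := by
  have hM : ∀ m : C, n • m = 0 := hn
  have hur : GaloisRep.IsUnramifiedOutside S (toGaloisModule S (ρ.subrepresentation C hC)) :=
    isUnramifiedOutside_toGaloisModule S (ρ.subrepresentation C hC)
  -- Howard's hypothesis on `T`: off `T`, `n` is invertible and `C` is unramified
  have hT : ∀ v : HeightOneSpectrum (𝓞 K), (Sum.inr v : Place K) ∉ T →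
      ((n : ℕ) : 𝓞 K) ∉ v.asIdeal ∧
        GaloisRep.IsUnramifiedAt v (toGaloisModule S (ρ.subrepresentation C hC)) := fun v hv => by
    have hvS : v ∉ S := fun h => hv ((hTinr v).2 h)
    exact ⟨fun h => hvS (hSn v h), hur v hvS⟩
  have hTS : ∀ v : HeightOneSpectrum (𝓞 K), (Sum.inr v : Place K) ∈ T → v ∈ S :=
    fun v hv => (hTinr v).1 hv
  -- `𝓕 ≤ 𝓖` and `s_v ∈ 𝓖_v` on `T`
  have hle : 𝓕 ≤ 𝓖 := by
    intro v
    by_cases hv : v ∈ T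
    · rw [h𝓖T v hv]; exact le_top
    · rcases v with w | v
      · exact absurd (hTinl w) hv
      · rw [h𝓕ur.2 v hv, h𝓖ur.2 v hv]
  have hsG : ∀ v ∈ T, s v ∈ 𝓖 v := fun v hv => by rw [h𝓖T v hv]; trivial
  -- Poitou–Tate (i) for THE canonical family at level `n`
  obtain ⟨xC, hxG, hxF⟩ := (selmerComplement_canonical_holds K n
    (toGaloisModule S (ρ.subrepresentation C hC)) hM T hT 𝓕 𝓖 hle h𝓕ur h𝓖ur).1 s hsG hvanish
  -- `xC` is inflated from `H¹(G_S, C)`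
  obtain ⟨c, hc⟩ := (toGaloisModule S (ρ.subrepresentation C hC)).mem_range_restrictedInf_of_mem_selmerGroup
    hur hTS h𝓖ur hxG
  -- the candidate
  refine ⟨Hmap (ρ.subrepresentation C hC) ρ C.subtypeL (fun _ _ ↦ rfl) 1
    (restrictedHAddEquiv S (ρ.subrepresentation C hC) 1 c), ?_⟩
  funext v
  obtain ⟨v, hvS⟩ := v
  have hvT : v ∈ T := by
    rcases v with w | v
    · exact hTinl w
    · exact (hTinr v).2 ((inSigma_inr_iff S v).1 hvS)
  -- the localisation of the candidate at `v`, through THE SQUARE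
  have hloc : loc S ρ v 1 (Hmap (ρ.subrepresentation C hC) ρ C.subtypeL (fun _ _ ↦ rfl) 1
        (restrictedHAddEquiv S (ρ.subrepresentation C hC) 1 c)) =
      Hmap (localRep S (ρ.subrepresentation C hC) v) (localRep S ρ v) C.subtypeL (fun _ _ ↦ rfl) 1
        (localHAddEquiv S (ρ.subrepresentation C hC) v 1
          (galoisCohomology.localization (toGaloisModule S (ρ.subrepresentation C hC)) v 1 xC)) := by
    rw [loc_Hmap_subtype_comm, loc_restrictedHAddEquiv,
      DiscreteGaloisModule.restrictedLocalization_apply, hc]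
  -- `loc_v xC = s_v + f_v` with `f_v ∈ 𝓕_v`
  have hfv : galoisCohomology.localization (toGaloisModule S (ρ.subrepresentation C hC)) v 1 xC - s v ∈
      𝓕 v := hxF v hvT
  have hmem : Hmap (localRep S (ρ.subrepresentation C hC) v) (localRep S ρ v) C.subtypeL
      (fun _ _ ↦ rfl) 1 (localHAddEquiv S (ρ.subrepresentation C hC) v 1
        (galoisCohomology.localization (toGaloisModule S (ρ.subrepresentation C hC)) v 1 xC - s v)) ∈
      L v :=
    (h𝓕T v hvT _).1 hfv
  change (L v).mkQ (loc S ρ v 1 _) = q ⟨v, hvS⟩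
  rw [hloc, ← hs ⟨v, hvS⟩, Submodule.mkQ_apply]
  refine (Submodule.Quotient.eq (L v)).2 ?_
  rw [← map_sub, ← map_sub]
  exact hmem

end Summit.BirchSwinnertonDyer.BirchSwinnertonDyer.Theorems.SurLambda

end
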